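import Literature.Probability.RandomPlanarGeometry.SAWCountMonotoneReversal
import HarnessLib

/-!
# Monotonicity `cₙ ≤ cₙ₊₁` (O'Brien 1990): doubling the first strict cut edge, and the reduction of
# the doubly trapped residual to the CUT-FREE walks

Sibling of `BDGS2012CountMonoOps.lean` (the doubling operation `dblAt k s ω` of an up-cut:
`dblAt_mem_saws`, `dblAt_injective`), `BDGS2012CountMonoExt.lean` (the extension identity
`cₙ₊₁ = Σ_ω extCount ω n`, `card_filter_restrictTo_eq`) and `SAWCountMonotoneReversal.lean`
(time reversal `revWalk`, the doubly trapped walks `T₂ = doublyTrapped d n` and the unconditional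
bound `cₙ ≤ cₙ₊₁ + #T₂`, `count_le_count_succ_add_card_doublyTrapped`) for the door
`cₙ ≤ cₙ₊₁` (O'Brien, *Monotonicity of the number of self-avoiding walks*, J. Stat. Phys. **59**
(1990) 969–979, quoted in BDGS 2012 §1.3 and Madras–Slade §7.1 p. 231).

A **strict cut edge** of an `n`-step self-avoiding walk `ω` on `ℤ^d` is a step `s → s+1`
(`s < n`) in a coordinate direction `±eₖ` such that the lattice hyperplane between `ω s` and
`ω (s+1)` separates the past `ω 0, …, ω s` from the future `ω (s+1), …, ω n` (`IsUpCut`,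
`IsDownCut`; equivalently: that hyperplane is crossed by exactly one step of the walk).  Doubling a
strict cut edge (`dblAt`, resp. its mirror image for a down-cut) gives an `(n+1)`-step self-avoiding
walk.  The point of this file is that doubling the FIRST strict cut edge is INJECTIVE on the walks
that have one, with an explicitly recognisable image:

* `IsUpCut.dblAt_isUpCut`, `isUpCut_of_isUpCut_dblAt`, `isDownCut_of_isDownCut_dblAt` : the doubled
  edge is again a strict cut edge of the doubled walk, and the doubled walk has NO strict cut edge
  before it that the original walk did not have — so the first cut time is preserved
  (`firstCut_cutDouble`) and the doubled walk determines the original (`cutDouble_injOn`);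
* the `n`-step prefix of a doubled walk still contains the doubled cut edge, so it is not cut-free
  (`not_cutFree_restrictTo_cutDouble`), whereas the one-step extensions of the **cut-free** walks
  (`cutFree d n`: no strict cut edge in any coordinate, either sign) have cut-free prefixes; the two
  families of `(n+1)`-step walks are disjoint, whence
  `count_add_sum_extCount_cutFree_le` : **`cₙ + Σ_{ψ cut-free} extCount ψ n ≤ cₙ₊₁ + #cutFree d n`**,
  i.e. O'Brien's inequality holds as soon as the cut-free `n`-step walks have on average at least
  one free extension;
* the cut-free class is invariant under time reversal (`cutFree_revWalk`), so the reversal pairing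
  of `SAWCountMonotoneReversal.lean` runs inside it (`card_cutFree_le`), giving the unconditional
  sharpening `count_le_count_succ_add_card_doublyTrapped_cutFree` :
  **`cₙ ≤ cₙ₊₁ + #(T₂ ∩ cutFree d n)`** of `cₙ ≤ cₙ₊₁ + #T₂`, and `cₙ ≤ cₙ₊₁` wherever no doubly
  trapped walk is cut-free (`count_le_count_succ_of_doublyTrapped_cutFree_eq_empty`).

A cut-free walk crosses every lattice hyperplane strictly inside its bounding box at least twice
in each coordinate, so it is a "folded-up" walk: on `ℤ²` there is no cut-free walk of length
`n ≤ 10` or `n = 12`, and the `32` cut-free walks of length `11` are the Hamiltonian paths of a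
`3 × 4` box between adjacent cells (exhaustive enumeration; of these `8` are doubly trapped).  No
named facts are introduced; the door `BDGS2012_count_mono` itself is not touched.
[cite: MadrasSlade1993, §1.1; §7.1 p. 231] [cite: BDGS2012, §1.3 (`cₙ ≤ cₙ₊₁`, O'Brien 1990)]
-/

noncomputable section

open Literature.Probability.LatticeModels Literature.Probability.Percolation SimpleGraph
open scoped BigOperators

namespace Literature.Probability.RandomPlanarGeometry.SAW.Zd

variable {d : ℕ}

/-! ### Strict cut edges -/

/-- `IsUpCut k s n ω`: the step `s → s+1` (`s < n`) of `ω` is `+eₖ` and the hyperplane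
`xₖ = ω s k + ½` separates the past (`xₖ ≤ ω s k` on `[0, s]`) from the future
(`xₖ ≥ ω s k + 1` on `[s+1, n]`) — the hypotheses of `dblAt_mem_saws`. [cite: MadrasSlade1993, §7.1] -/
def IsUpCut (k : Fin d) (s n : ℕ) (ω : ℕ → Site d) : Prop :=
  s < n ∧ ω (s + 1) = ω s + Pi.single k 1 ∧ (∀ i ≤ s, ω i k ≤ ω s k) ∧
    ∀ i, s + 1 ≤ i → i ≤ n → ω s k + 1 ≤ ω i k

/-- `IsDownCut k s n ω`: the step `s → s+1` is `-eₖ` and the hyperplane `xₖ = ω s k - ½` separates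
past from future; by definition an up-cut of the mirror image `-ω`. [cite: MadrasSlade1993, §7.1] -/
def IsDownCut (k : Fin d) (s n : ℕ) (ω : ℕ → Site d) : Prop :=
  IsUpCut k s n (-ω)

/-- `HasCutAt s n ω`: the step `s → s+1` of `ω` is a strict cut edge (in some coordinate, of either
sign). [cite: MadrasSlade1993, §7.1] -/
def HasCutAt (s n : ℕ) (ω : ℕ → Site d) : Prop :=
  ∃ k, IsUpCut k s n ω ∨ IsDownCut k s n ω

/-- `CutFree n ω`: the walk has no strict cut edge during `[0, n]`. [cite: MadrasSlade1993, §7.1] -/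
def CutFree (n : ℕ) (ω : ℕ → Site d) : Prop :=
  ∀ s, ¬ HasCutAt s n ω

open Classical in
/-- The **cut-free** `n`-step self-avoiding walks on `ℤ^d`. [cite: MadrasSlade1993, §7.1] -/
def cutFree (d n : ℕ) : Finset (ℕ → Site d) :=
  (saws d n).filter (CutFree n)

/-- Membership in `cutFree`. [cite: MadrasSlade1993, §7.1] -/
theorem mem_cutFree {n : ℕ} {ω : ℕ → Site d} : ω ∈ cutFree d n ↔ ω ∈ saws d n ∧ CutFree n ω := by
  classical
  rw [cutFree, Finset.mem_filter]

/-- The mirror image `-ω` of a self-avoiding walk from `0` is one. [folklore] -/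
private theorem neg_mem_saws' {n : ℕ} {ω : ℕ → Site d} (hω : ω ∈ saws d n) : -ω ∈ saws d n :=
  neg_mem_saws hω

/-- An up-cut of `-ω` is a down-cut of `ω` (and conversely, by definition). [folklore] -/
private theorem isUpCut_neg_iff {k : Fin d} {s n : ℕ} {ω : ℕ → Site d} :
    IsUpCut k s n (-ω) ↔ IsDownCut k s n ω := Iff.rfl

/-- A down-cut of `-ω` is an up-cut of `ω`. [folklore] -/
private theorem isDownCut_neg_iff {k : Fin d} {s n : ℕ} {ω : ℕ → Site d} :
    IsDownCut k s n (-ω) ↔ IsUpCut k s n ω := by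
  rw [IsDownCut, neg_neg]

/-- The cut times of `-ω` are those of `ω`. [folklore] -/
private theorem hasCutAt_neg_iff {s n : ℕ} {ω : ℕ → Site d} : HasCutAt s n (-ω) ↔ HasCutAt s n ω := by
  simp only [HasCutAt, isUpCut_neg_iff, isDownCut_neg_iff, or_comm]

/-- At a given time the direction of an up-cut is determined (it is the direction of the step).
[folklore] -/
private theorem IsUpCut.eq_of_isUpCut {k k' : Fin d} {s n : ℕ} {ω : ℕ → Site d} (h : IsUpCut k s n ω)
    (h' : IsUpCut k' s n ω) : k = k' := by
  have h1 := h.2.1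
  rw [h'.2.1] at h1
  have h2 : (Pi.single k' (1 : ℤ) : Site d) = Pi.single k 1 := add_left_cancel h1
  by_contra hne
  have := congrFun h2 k'
  rw [Pi.single_eq_same, Pi.single_eq_of_ne (Ne.symm hne)] at this
  exact one_ne_zero this

/-- A step cannot be an up-cut and a down-cut at the same time. [folklore] -/
private theorem IsUpCut.not_isDownCut {k k' : Fin d} {s n : ℕ} {ω : ℕ → Site d} (h : IsUpCut k s n ω)
    (h' : IsDownCut k' s n ω) : False := by
  have h1 : ω (s + 1) = ω s + Pi.single k 1 := h.2.1
  have h2 : -ω (s + 1) = -ω s + Pi.single k' 1 := h'.2.1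
  rw [h1, neg_add] at h2
  have h3 : -(Pi.single k (1 : ℤ) : Site d) = Pi.single k' 1 := add_left_cancel h2
  have := congrFun h3 k'
  rw [Pi.neg_apply, Pi.single_eq_same] at this
  by_cases hk : k' = k
  · subst hk
    rw [Pi.single_eq_same] at this
    omega
  · rw [Pi.single_eq_of_ne hk] at this
    omega

/-! ### Doubling an up-cut: the doubled edge stays a cut, no earlier cut appears -/

/-- Doubling an up-cut of an `n`-step self-avoiding walk gives an `(n+1)`-step self-avoiding walk
(`dblAt_mem_saws`). [cite: MadrasSlade1993, §7.1] -/
theorem IsUpCut.dblAt_mem_saws {k : Fin d} {s n : ℕ} {ω : ℕ → Site d} (hω : ω ∈ saws d n)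
    (h : IsUpCut k s n ω) : dblAt k s ω ∈ saws d (n + 1) :=
  Zd.dblAt_mem_saws hω h.1 h.2.1 h.2.2.1 h.2.2.2

/-- The doubled edge is again an up-cut of the doubled walk (horizon `n + 1`). [cite: MadrasSlade1993, §7.1] -/
theorem IsUpCut.dblAt_isUpCut {k : Fin d} {s n : ℕ} {ω : ℕ → Site d} (h : IsUpCut k s n ω) :
    IsUpCut k s (n + 1) (dblAt k s ω) := by
  obtain ⟨hs, hstep, hpast, hfut⟩ := h
  have hsk : ω (s + 1) k = ω s k + 1 := by rw [hstep]; simp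
  refine ⟨by omega, ?_, ?_, ?_⟩
  · rw [dblAt_of_le le_rfl, dblAt_of_le (Nat.le_succ s), hstep]
  · intro i hi
    rw [dblAt_of_le (by omega), dblAt_of_le (Nat.le_succ s)]
    exact hpast i hi
  · intro i hi hin
    rw [dblAt_of_le (Nat.le_succ s)]
    rcases Nat.lt_or_ge (s + 1) i with hlt | hge
    · rw [dblAt_of_lt hlt, Pi.add_apply, Pi.single_eq_same]
      have := hfut (i - 1) (by omega) (by omega)
      omega
    · have : i = s + 1 := le_antisymm hge hi
      rw [this, dblAt_of_le le_rfl, hsk]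

/-- An up-cut of the doubled walk at a time BEFORE the doubled edge is an up-cut of the original
walk. [cite: MadrasSlade1993, §7.1] -/
theorem isUpCut_of_isUpCut_dblAt {k k' : Fin d} {s s' n : ℕ} {ω : ℕ → Site d}
    (h : IsUpCut k s n ω) (hs' : s' < s) (h' : IsUpCut k' s' (n + 1) (dblAt k s ω)) :
    IsUpCut k' s' n ω := by
  obtain ⟨hs, hstep, -, hfut⟩ := h
  obtain ⟨-, hstep', hpast', hfut'⟩ := h'
  rw [dblAt_of_le (by omega), dblAt_of_le (by omega)] at hstep'
  refine ⟨by omega, hstep', fun i hi => ?_, fun i hi hin => ?_⟩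
  · have := hpast' i hi
    rwa [dblAt_of_le (by omega), dblAt_of_le (by omega)] at this
  · have hs'v : dblAt k s ω s' = ω s' := dblAt_of_le (by omega)
    rcases Nat.lt_or_ge s i with hsi | hsi
    · -- `i ≥ s + 1`: read the doubled walk at time `i + 1`, where it is `ω i + eₖ`
      by_cases hk : k' = k
      · subst hk
        have h1 := hfut' s (by omega) (by omega)
        rw [hs'v, dblAt_of_le (Nat.le_succ s)] at h1
        have h2 := hfut i (by omega) hin
        omega
      · have h1 := hfut' (i + 1) (by omega) (by omega)
        rw [hs'v, dblAt_succ (by omega), Pi.add_apply, Pi.single_eq_of_ne hk, add_zero] at h1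
        exact h1
    · have h1 := hfut' i hi (by omega)
      rwa [hs'v, dblAt_of_le (by omega)] at h1

/-- A down-cut of the doubled walk at a time BEFORE the doubled edge is a down-cut of the original
walk. [cite: MadrasSlade1993, §7.1] -/
theorem isDownCut_of_isDownCut_dblAt {k k' : Fin d} {s s' n : ℕ} {ω : ℕ → Site d}
    (h : IsUpCut k s n ω) (hs' : s' < s) (h' : IsDownCut k' s' (n + 1) (dblAt k s ω)) :
    IsDownCut k' s' n ω := by
  obtain ⟨hs, -, -, -⟩ := h
  obtain ⟨-, hstep', hpast', hfut'⟩ := h'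
  simp only [Pi.neg_apply] at hstep' hpast' hfut'
  rw [dblAt_of_le (by omega), dblAt_of_le (by omega)] at hstep'
  refine ⟨by omega, by simpa only [Pi.neg_apply] using hstep', fun i hi => ?_, fun i hi hin => ?_⟩
  · have := hpast' i hi
    simp only [Pi.neg_apply]
    rwa [dblAt_of_le (by omega), dblAt_of_le (by omega)] at this
  · have hs'v : dblAt k s ω s' = ω s' := dblAt_of_le (by omega)
    simp only [Pi.neg_apply]
    rcases Nat.lt_or_ge s i with hsi | hsi
    · have h1 := hfut' (i + 1) (by omega) (by omega)
      rw [hs'v, dblAt_succ (by omega), Pi.add_apply] at h1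
      by_cases hk : k' = k
      · subst hk
        rw [Pi.single_eq_same] at h1
        omega
      · rw [Pi.single_eq_of_ne hk] at h1
        omega
    · have h1 := hfut' i hi (by omega)
      rwa [hs'v, dblAt_of_le (by omega)] at h1

/-- No cut of the doubled walk appears before the doubled (up-)cut. [cite: MadrasSlade1993, §7.1] -/
theorem hasCutAt_of_hasCutAt_dblAt {k : Fin d} {s s' n : ℕ} {ω : ℕ → Site d}
    (h : IsUpCut k s n ω) (hs' : s' < s) (h' : HasCutAt s' (n + 1) (dblAt k s ω)) :
    HasCutAt s' n ω := by
  obtain ⟨k', hk' | hk'⟩ := h'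
  · exact ⟨k', Or.inl (isUpCut_of_isUpCut_dblAt h hs' hk')⟩
  · exact ⟨k', Or.inr (isDownCut_of_isDownCut_dblAt h hs' hk')⟩

/-- Restricting the horizon: an up-cut for the horizon `n + 1` at a time `s < n` is an up-cut for
the horizon `n`. [folklore] -/
private theorem IsUpCut.of_succ {k : Fin d} {s n : ℕ} {ω : ℕ → Site d} (h : IsUpCut k s (n + 1) ω)
    (hs : s < n) : IsUpCut k s n ω :=
  ⟨hs, h.2.1, h.2.2.1, fun i hi hin => h.2.2.2 i hi (by omega)⟩

/-- Up-cuts only depend on the walk during `[0, n]`. [folklore] -/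
private theorem IsUpCut.congr {k : Fin d} {s n : ℕ} {ω₁ ω₂ : ℕ → Site d} (h : IsUpCut k s n ω₁)
    (he : ∀ i ≤ n, ω₁ i = ω₂ i) : IsUpCut k s n ω₂ := by
  obtain ⟨hs, hstep, hpast, hfut⟩ := h
  refine ⟨hs, ?_, fun i hi => ?_, fun i hi hin => ?_⟩
  · rw [← he (s + 1) (by omega), ← he s (by omega), hstep]
  · rw [← he i (by omega), ← he s (by omega)]; exact hpast i hi
  · rw [← he i hin, ← he s (by omega)]; exact hfut i hi hin

/-! ### Doubling the first strict cut edge -/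

/-- A cut time that carries no up-cut carries a down-cut. [folklore] -/
private theorem HasCutAt.exists_isDownCut {s n : ℕ} {ω : ℕ → Site d} (h : HasCutAt s n ω)
    (hu : ¬ ∃ k, IsUpCut k s n ω) : ∃ k, IsDownCut k s n ω := by
  obtain ⟨k, hk | hk⟩ := h
  · exact (hu ⟨k, hk⟩).elim
  · exact ⟨k, hk⟩

open Classical in
/-- **Doubling the first strict cut edge.** If `ω` has a strict cut edge during `[0, n]`, let `s`
be the first cut time; if the step `s → s+1` is an up-cut `+eₖ`, double it (`dblAt k s ω`); if it
is a down-cut `-eₖ`, double it as the mirror image of the doubling of the up-cut of `-ω`.  (On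
walks without a cut edge the map is the identity, an irrelevant junk value.)
[cite: MadrasSlade1993, §7.1] -/
def cutDouble (n : ℕ) (ω : ℕ → Site d) : ℕ → Site d :=
  if h : ∃ s, HasCutAt s n ω then
    if hu : ∃ k, IsUpCut k (Nat.find h) n ω then dblAt (Classical.choose hu) (Nat.find h) ω
    else -dblAt (Classical.choose ((Nat.find_spec h).exists_isDownCut hu)) (Nat.find h) (-ω)
  else ω

/-- What `cutDouble` does, case by case: there are a first cut time `s` and a direction `k` such
that either `(k, s)` is an up-cut of `ω` and `cutDouble n ω = dblAt k s ω`, or `(k, s)` is a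
down-cut of `ω` (an up-cut of `-ω`) and `cutDouble n ω = -dblAt k s (-ω)`; in both cases no
earlier time is a cut time. [cite: MadrasSlade1993, §7.1] -/
theorem cutDouble_spec {n : ℕ} {ω : ℕ → Site d} (h : ∃ s, HasCutAt s n ω) :
    ∃ s k, (∀ s' < s, ¬ HasCutAt s' n ω) ∧
      ((IsUpCut k s n ω ∧ cutDouble n ω = dblAt k s ω) ∨
        (IsUpCut k s n (-ω) ∧ cutDouble n ω = -dblAt k s (-ω))) := by
  classical
  refine ⟨Nat.find h, ?_⟩
  have hmin : ∀ s' < Nat.find h, ¬ HasCutAt s' n ω := fun s' hs' => Nat.find_min h hs'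
  by_cases hu : ∃ k, IsUpCut k (Nat.find h) n ω
  · refine ⟨Classical.choose hu, hmin, Or.inl ⟨Classical.choose_spec hu, ?_⟩⟩
    rw [cutDouble, dif_pos h, dif_pos hu]
  · have hd := (Nat.find_spec h).exists_isDownCut hu
    refine ⟨Classical.choose hd, hmin, Or.inr ⟨Classical.choose_spec hd, ?_⟩⟩
    rw [cutDouble, dif_pos h, dif_neg hu]

/-- The doubled walk is an `(n+1)`-step self-avoiding walk. [cite: MadrasSlade1993, §7.1] -/
theorem cutDouble_mem_saws {n : ℕ} {ω : ℕ → Site d} (hω : ω ∈ saws d n) (h : ∃ s, HasCutAt s n ω) :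
    cutDouble n ω ∈ saws d (n + 1) := by
  obtain ⟨s, k, -, ⟨hk, he⟩ | ⟨hk, he⟩⟩ := cutDouble_spec h
  · rw [he]; exact hk.dblAt_mem_saws hω
  · rw [he]; exact neg_mem_saws' (hk.dblAt_mem_saws (neg_mem_saws' hω))

/-- **The first cut time is preserved by doubling**: the doubled walk has a cut at the first cut
time `s` of `ω` (the doubled edge, of the same sign) and no cut before `s`. [cite: MadrasSlade1993, §7.1] -/
theorem firstCut_cutDouble {n : ℕ} {ω : ℕ → Site d} (h : ∃ s, HasCutAt s n ω) :
    ∃ s, HasCutAt s n ω ∧ (∀ s' < s, ¬ HasCutAt s' n ω) ∧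
      HasCutAt s (n + 1) (cutDouble n ω) ∧ ∀ s' < s, ¬ HasCutAt s' (n + 1) (cutDouble n ω) := by
  obtain ⟨s, k, hmin, ⟨hk, he⟩ | ⟨hk, he⟩⟩ := cutDouble_spec h
  · refine ⟨s, ⟨k, Or.inl hk⟩, hmin, ?_, fun s' hs' hc => hmin s' hs' ?_⟩
    · rw [he]; exact ⟨k, Or.inl hk.dblAt_isUpCut⟩
    · rw [he] at hc; exact hasCutAt_of_hasCutAt_dblAt hk hs' hc
  · refine ⟨s, ⟨k, Or.inr hk⟩, hmin, ?_, fun s' hs' hc => hmin s' hs' ?_⟩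
    · rw [he]
      refine ⟨k, Or.inr ?_⟩
      rw [IsDownCut, neg_neg]
      exact hk.dblAt_isUpCut
    · rw [he, hasCutAt_neg_iff] at hc
      exact hasCutAt_neg_iff.1 (hasCutAt_of_hasCutAt_dblAt hk hs' hc)

/-- The first cut time of a walk with a cut, as the least cut time, is unique. [folklore] -/
private theorem firstCut_unique {n : ℕ} {ω : ℕ → Site d} {s₁ s₂ : ℕ} (h₁ : HasCutAt s₁ n ω)
    (hmin₁ : ∀ s' < s₁, ¬ HasCutAt s' n ω) (h₂ : HasCutAt s₂ n ω)
    (hmin₂ : ∀ s' < s₂, ¬ HasCutAt s' n ω) : s₁ = s₂ := by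
  rcases lt_trichotomy s₁ s₂ with h | h | h
  · exact (hmin₂ s₁ h h₁).elim
  · exact h
  · exact (hmin₁ s₂ h h₂).elim

/-- **Doubling the first strict cut edge is injective** on the `n`-step walks that have a cut
edge: the image determines the first cut time (it is its own first cut time), the sign and the
direction of the doubled edge (the step of the image there), and `dblAt k s` is injective.
[cite: MadrasSlade1993, §7.1] -/
theorem cutDouble_injOn (n : ℕ) :
    Set.InjOn (cutDouble (d := d) n) {ω | ∃ s, HasCutAt s n ω} := by
  intro ω₁ h₁ ω₂ h₂ heq
  simp only [Set.mem_setOf_eq] at h₁ h₂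
  obtain ⟨s₁, k₁, hmin₁, hc₁⟩ := cutDouble_spec h₁
  obtain ⟨s₂, k₂, hmin₂, hc₂⟩ := cutDouble_spec h₂
  -- the first cut times of the two images agree, hence `s₁ = s₂`
  obtain ⟨t₁, ht₁, htmin₁, hT₁, hTmin₁⟩ := firstCut_cutDouble h₁
  obtain ⟨t₂, ht₂, htmin₂, hT₂, hTmin₂⟩ := firstCut_cutDouble h₂
  have hs₁ : s₁ = t₁ := by
    rcases hc₁ with ⟨hk, -⟩ | ⟨hk, -⟩
    · exact firstCut_unique ⟨k₁, Or.inl hk⟩ hmin₁ ht₁ htmin₁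
    · exact firstCut_unique ⟨k₁, Or.inr hk⟩ hmin₁ ht₁ htmin₁
  have hs₂ : s₂ = t₂ := by
    rcases hc₂ with ⟨hk, -⟩ | ⟨hk, -⟩
    · exact firstCut_unique ⟨k₂, Or.inl hk⟩ hmin₂ ht₂ htmin₂
    · exact firstCut_unique ⟨k₂, Or.inr hk⟩ hmin₂ ht₂ htmin₂
  rw [heq] at hT₁ hTmin₁
  have ht : t₁ = t₂ := firstCut_unique hT₁ hTmin₁ hT₂ hTmin₂
  have hs : s₂ = s₁ := by rw [hs₁, hs₂, ht]
  subst hs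
  rcases hc₁ with ⟨hk₁, he₁⟩ | ⟨hk₁, he₁⟩ <;> rcases hc₂ with ⟨hk₂, he₂⟩ | ⟨hk₂, he₂⟩
  · -- up / up
    have hW₁ : IsUpCut k₁ s₂ (n + 1) (cutDouble n ω₂) := by rw [← heq, he₁]; exact hk₁.dblAt_isUpCut
    have hW₂ : IsUpCut k₂ s₂ (n + 1) (cutDouble n ω₂) := by rw [he₂]; exact hk₂.dblAt_isUpCut
    have hk : k₁ = k₂ := hW₁.eq_of_isUpCut hW₂
    subst hk
    rw [he₁, he₂] at heq
    exact dblAt_injective k₁ s₂ heq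
  · -- up / down: impossible
    have hW₁ : IsUpCut k₁ s₂ (n + 1) (cutDouble n ω₂) := by rw [← heq, he₁]; exact hk₁.dblAt_isUpCut
    have hW₂ : IsDownCut k₂ s₂ (n + 1) (cutDouble n ω₂) := by
      rw [he₂, IsDownCut, neg_neg]; exact hk₂.dblAt_isUpCut
    exact (hW₁.not_isDownCut hW₂).elim
  · -- down / up: impossible
    have hW₁ : IsDownCut k₁ s₂ (n + 1) (cutDouble n ω₂) := by
      rw [← heq, he₁, IsDownCut, neg_neg]; exact hk₁.dblAt_isUpCut
    have hW₂ : IsUpCut k₂ s₂ (n + 1) (cutDouble n ω₂) := by rw [he₂]; exact hk₂.dblAt_isUpCut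
    exact (hW₂.not_isDownCut hW₁).elim
  · -- down / down
    have hW₁ : IsUpCut k₁ s₂ (n + 1) (-cutDouble n ω₂) := by
      rw [← heq, he₁, neg_neg]; exact hk₁.dblAt_isUpCut
    have hW₂ : IsUpCut k₂ s₂ (n + 1) (-cutDouble n ω₂) := by rw [he₂, neg_neg]; exact hk₂.dblAt_isUpCut
    have hk : k₁ = k₂ := hW₁.eq_of_isUpCut hW₂
    subst hk
    rw [he₁, he₂] at heq
    have := dblAt_injective k₁ s₂ (neg_injective heq)
    exact neg_injective this

/-- The `n`-step prefix of a doubled walk is NOT cut-free: it still contains the doubled cut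
edge (whose time is `< n`). [cite: MadrasSlade1993, §7.1] -/
theorem not_cutFree_restrictTo_cutDouble {n : ℕ} {ω : ℕ → Site d} (h : ∃ s, HasCutAt s n ω) :
    ¬ CutFree n (restrictTo (cutDouble n ω) n) := by
  obtain ⟨s, k, -, ⟨hk, he⟩ | ⟨hk, he⟩⟩ := cutDouble_spec h
  · intro hcf
    refine hcf s ⟨k, Or.inl ?_⟩
    have h1 : IsUpCut k s n (dblAt k s ω) := hk.dblAt_isUpCut.of_succ hk.1
    rw [he]
    exact h1.congr fun i hi => by rw [restrictTo_apply, min_eq_left hi]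
  · intro hcf
    refine hcf s ⟨k, Or.inr ?_⟩
    have h1 : IsUpCut k s n (dblAt k s (-ω)) := hk.dblAt_isUpCut.of_succ hk.1
    rw [he, IsDownCut]
    exact h1.congr fun i hi => by simp only [Pi.neg_apply, restrictTo_apply, min_eq_left hi, neg_neg]

/-! ### The counting inequality: `cₙ + Σ_{cut-free} extCount ≤ cₙ₊₁ + #cut-free` -/

open Classical in
/-- The one-step extensions of the cut-free `n`-step walks number `Σ_{ψ cut-free} extCount ψ n`, and
the `(n+1)`-step walks whose `n`-step prefix has a cut edge number `Σ_{ψ not cut-free} extCount ψ n`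
(fibres of the restriction map, `card_filter_restrictTo_eq`). [cite: MadrasSlade1993, §1.1, eq. (1.1.1)] -/
theorem card_filter_restrictTo_mem_eq_sum {n : ℕ} (S : Finset (ℕ → Site d)) (hS : S ⊆ saws d n) :
    ((saws d (n + 1)).filter fun q => restrictTo q n ∈ S).card = ∑ ψ ∈ S, extCount ψ n := by
  classical
  rw [Finset.card_eq_sum_card_fiberwise (f := fun q => restrictTo q n) (t := S)
    (fun q hq => by
      have := (Finset.mem_filter.1 (Finset.mem_coe.1 hq)).2
      exact Finset.mem_coe.2 this)]
  refine Finset.sum_congr rfl fun ψ hψ => ?_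
  rw [← card_filter_restrictTo_eq (hS hψ)]
  congr 1
  ext q
  simp only [Finset.mem_filter]
  constructor
  · rintro ⟨⟨hq, -⟩, hres⟩; exact ⟨hq, hres⟩
  · rintro ⟨hq, hres⟩; exact ⟨⟨hq, hres ▸ hψ⟩, hres⟩

open Classical in
/-- **`cₙ + Σ_{ψ cut-free} extCount ψ n ≤ cₙ₊₁ + #cutFree d n`.**  Doubling the first strict cut edge
sends the `n`-step walks WITH a cut edge injectively to `(n+1)`-step walks whose `n`-step prefix has a
cut edge; these are disjoint from the one-step extensions of the cut-free walks (whose prefixes are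
cut-free), and the two families together have at most `cₙ₊₁` members. Equivalently
`cₙ₊₁ - cₙ ≥ Σ_{ψ cut-free} (extCount ψ n - 1)`: O'Brien's inequality holds at length `n` as soon as
the cut-free `n`-step walks have on average at least one free extension.
[cite: BDGS2012, §1.3 (`cₙ ≤ cₙ₊₁`, O'Brien 1990)] [cite: MadrasSlade1993, §7.1] -/
theorem count_add_sum_extCount_cutFree_le (d n : ℕ) :
    count d n + ∑ ψ ∈ cutFree d n, extCount ψ n ≤ count d (n + 1) + (cutFree d n).card := by
  classical
  set C := (saws d n).filter fun ω => ¬ CutFree n ω with hC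
  set A := (saws d (n + 1)).filter fun q => restrictTo q n ∈ C with hA
  set B := (saws d (n + 1)).filter fun q => restrictTo q n ∈ cutFree d n with hB
  -- `cₙ = #C + #cut-free`
  have hsplit : (cutFree d n).card + C.card = count d n := by
    rw [← card_saws d n, cutFree, hC]
    exact Finset.card_filter_add_card_filter_not _
  -- the doubling injection `C ↪ A`
  have hCA : C.card ≤ A.card := by
    refine Finset.card_le_card_of_injOn (cutDouble n) (fun ω hω => ?_) fun ω₁ h₁ ω₂ h₂ he => ?_
    · obtain ⟨hω, hnc⟩ := Finset.mem_filter.1 hω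
      have hex : ∃ s, HasCutAt s n ω := by
        by_contra hne
        exact hnc fun s hs => hne ⟨s, hs⟩
      refine Finset.mem_filter.2 ⟨cutDouble_mem_saws hω hex, Finset.mem_filter.2 ⟨?_, ?_⟩⟩
      · exact restrictTo_mem_saws (cutDouble_mem_saws hω hex)
      · exact not_cutFree_restrictTo_cutDouble hex
    · have hex : ∀ {ω}, ω ∈ (C : Set (ℕ → Site d)) → ω ∈ {ω : ℕ → Site d | ∃ s, HasCutAt s n ω} := by
        intro ω hω
        obtain ⟨-, hnc⟩ := Finset.mem_filter.1 (Finset.mem_coe.1 hω)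
        by_contra hne
        exact hnc fun s hs => hne ⟨s, hs⟩
      exact cutDouble_injOn n (hex h₁) (hex h₂) he
  -- the fibre counts
  have hAsum : A.card = ∑ ψ ∈ C, extCount ψ n :=
    card_filter_restrictTo_mem_eq_sum C (Finset.filter_subset _ _)
  have hBsum : B.card = ∑ ψ ∈ cutFree d n, extCount ψ n :=
    card_filter_restrictTo_mem_eq_sum (cutFree d n) (Finset.filter_subset _ _)
  -- `A` and `B` are disjoint inside `saws d (n+1)`
  have hAB : A.card + B.card ≤ count d (n + 1) := by
    rw [← card_saws d (n + 1), ← Finset.card_union_of_disjoint]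
    · exact Finset.card_le_card (Finset.union_subset (Finset.filter_subset _ _) (Finset.filter_subset _ _))
    · rw [Finset.disjoint_left]
      intro q hqA hqB
      have h1 := (Finset.mem_filter.1 (Finset.mem_filter.1 hqA).2).2
      have h2 := (mem_cutFree.1 (Finset.mem_filter.1 hqB).2).2
      exact h1 h2
  omega

/-! ### Time reversal preserves the cut-free class -/

/-- Reversal turns an up-cut at time `s` into an up-cut at time `n - 1 - s` (the walk is read
backwards and recentred; the separating hyperplane is carried along). [cite: MadrasSlade1993, §1.1] -/
theorem IsUpCut.revWalk {k : Fin d} {s n : ℕ} {ω : ℕ → Site d} (h : IsUpCut k s n ω) :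
    IsUpCut k (n - 1 - s) n (revWalk n ω) := by
  obtain ⟨hs, hstep, hpast, hfut⟩ := h
  have hsk : ω (s + 1) k = ω s k + 1 := by rw [hstep]; simp
  have e1 : n - (n - 1 - s) = s + 1 := by omega
  have e2 : n - (n - 1 - s + 1) = s := by omega
  refine ⟨by omega, ?_, fun i hi => ?_, fun i hi hin => ?_⟩
  · simp only [Zd.revWalk, e1, e2, hstep]
    abel
  · simp only [Zd.revWalk, e1, Pi.sub_apply, hsk]
    have := hfut (n - i) (by omega) (by omega)
    omega
  · simp only [Zd.revWalk, e1, Pi.sub_apply, hsk]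
    have := hpast (n - i) (by omega)
    omega

/-- Reversal commutes with the mirror image. [folklore] -/
private theorem revWalk_neg (n : ℕ) (ω : ℕ → Site d) : revWalk n (-ω) = -revWalk n ω := by
  funext i
  simp only [Zd.revWalk, Pi.neg_apply]
  abel

/-- Reversal turns a cut time `s` into the cut time `n - 1 - s`. [cite: MadrasSlade1993, §1.1] -/
theorem HasCutAt.revWalk {s n : ℕ} {ω : ℕ → Site d} (h : HasCutAt s n ω) :
    HasCutAt (n - 1 - s) n (revWalk n ω) := by
  obtain ⟨k, hk | hk⟩ := h
  · exact ⟨k, Or.inl hk.revWalk⟩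
  · refine ⟨k, Or.inr ?_⟩
    rw [IsDownCut, ← revWalk_neg]
    exact IsUpCut.revWalk hk

/-- **The cut-free class is invariant under time reversal.** [cite: MadrasSlade1993, §1.1] -/
theorem cutFree_revWalk {n : ℕ} {ω : ℕ → Site d} (hω : ω ∈ cutFree d n) :
    revWalk n ω ∈ cutFree d n := by
  obtain ⟨hω, hcf⟩ := mem_cutFree.1 hω
  refine mem_cutFree.2 ⟨revWalk_mem_saws hω, fun s hs => ?_⟩
  have := hs.revWalk
  rw [revWalk_revWalk hω] at this
  exact hcf _ this

/-! ### The reversal pairing inside the cut-free class -/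

open Classical in
/-- **`#cutFree ≤ Σ_{ψ cut-free} extCount ψ n + #(T₂ ∩ cutFree)`.**  Inside the (reversal-invariant)
cut-free class, a walk with an end-trapped end but at least two free sites at its start is the
reversal of a cut-free walk with at least two free end-extensions; these reversals pay the unit
deficit of such walks, and only the doubly trapped cut-free walks (end trapped, at most one free
start site) are left uncompensated. [cite: BDGS2012, §1.3] [cite: MadrasSlade1993, §1.1] -/
theorem card_cutFree_le (d n : ℕ) :
    (cutFree d n).card ≤
      ∑ ψ ∈ cutFree d n, extCount ψ n + (doublyTrapped d n ∩ cutFree d n).card := by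
  classical
  set R := cutFree d n with hR
  set S₁ := R.filter fun ψ => 1 ≤ extCount ψ n with hS₁
  set S₀₂ := R.filter fun ψ => extCount ψ n = 0 ∧ 2 ≤ extCount (revWalk n ψ) n with hS₀₂
  set T := R.filter fun ψ => extCount ψ n = 0 ∧ extCount (revWalk n ψ) n ≤ 1 with hT
  -- partition of `R`
  have hpart : R.card = S₁.card + (S₀₂.card + T.card) := by
    have h1 : S₁.card + (R.filter fun ψ => ¬ 1 ≤ extCount ψ n).card = R.card :=
      Finset.card_filter_add_card_filter_not _
    have h2 : (R.filter fun ψ => ¬ 1 ≤ extCount ψ n) =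
        (R.filter fun ψ => extCount ψ n = 0) := by
      congr 1; funext ψ; simp only [not_le, Nat.lt_one_iff]
    rw [h2] at h1
    have h3 : S₀₂.card + T.card = (R.filter fun ψ => extCount ψ n = 0).card := by
      have := Finset.card_filter_add_card_filter_not
        (s := R.filter fun ψ => extCount ψ n = 0) (fun ψ => 2 ≤ extCount (revWalk n ψ) n)
      rw [Finset.filter_filter, Finset.filter_filter] at this
      have e : (R.filter fun ψ => extCount ψ n = 0 ∧ ¬ 2 ≤ extCount (revWalk n ψ) n) = T := by
        rw [hT]; congr 1; funext ψ; simp only [not_le, Nat.lt_succ_iff]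
      rw [e] at this
      exact this
    omega
  -- `T = T₂ ∩ R`
  have hTeq : T = doublyTrapped d n ∩ R := by
    ext ψ
    simp only [hT, Finset.mem_filter, Finset.mem_inter, mem_doublyTrapped, hR, mem_cutFree]
    tauto
  -- `Σ_R ext ≥ #S₁ + #(S₁ ∩ {ext ≥ 2})`
  have hsum : S₁.card + (S₁.filter fun ψ => 2 ≤ extCount ψ n).card ≤ ∑ ψ ∈ R, extCount ψ n := by
    have h1 : ∑ ψ ∈ S₁, extCount ψ n ≤ ∑ ψ ∈ R, extCount ψ n :=
      Finset.sum_le_sum_of_subset (Finset.filter_subset _ _)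
    have h2 : S₁.card + (S₁.filter fun ψ => 2 ≤ extCount ψ n).card ≤ ∑ ψ ∈ S₁, extCount ψ n := by
      have e1 : S₁.card = ∑ ψ ∈ S₁, 1 := Finset.card_eq_sum_ones S₁
      have e2 : (S₁.filter fun ψ => 2 ≤ extCount ψ n).card =
          ∑ ψ ∈ S₁, if 2 ≤ extCount ψ n then 1 else 0 := by
        rw [Finset.card_eq_sum_ones, Finset.sum_filter]
      rw [e1, e2, ← Finset.sum_add_distrib]
      refine Finset.sum_le_sum fun ψ hψ => ?_
      have := (Finset.mem_filter.1 hψ).2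
      split_ifs with h <;> omega
    exact h2.trans h1
  -- the reversal injection `S₀₂ ↪ S₁ ∩ {ext ≥ 2}`
  have hinj : S₀₂.card ≤ (S₁.filter fun ψ => 2 ≤ extCount ψ n).card := by
    refine Finset.card_le_card_of_injOn (revWalk n) (fun ψ hψ => ?_) fun ψ₁ h₁ ψ₂ h₂ he => ?_
    · obtain ⟨hψR, h0, h2⟩ := Finset.mem_filter.1 hψ
      refine Finset.mem_filter.2 ⟨Finset.mem_filter.2 ⟨cutFree_revWalk hψR, by omega⟩, h2⟩
    · have hs₁ := (mem_cutFree.1 (Finset.mem_filter.1 (Finset.mem_coe.1 h₁)).1).1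
      have hs₂ := (mem_cutFree.1 (Finset.mem_filter.1 (Finset.mem_coe.1 h₂)).1).1
      exact revWalk_injOn n (Finset.mem_coe.2 hs₁) (Finset.mem_coe.2 hs₂) he
  rw [← hTeq]
  omega

/-! ### The unconditional bound and the reduction -/

open Classical in
/-- **`cₙ ≤ cₙ₊₁ + #(T₂ ∩ cutFree d n)`.**  The number of `n`-step self-avoiding walks exceeds the
number of `(n+1)`-step ones by at most the number of doubly trapped walks (end trapped, at most one
free start site) that are moreover CUT-FREE (no strict cut edge in any coordinate): a sharpening of
`count_le_count_succ_add_card_doublyTrapped` (`cₙ ≤ cₙ₊₁ + #T₂`) by the cut-edge doubling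
injection. [cite: BDGS2012, §1.3 (`cₙ ≤ cₙ₊₁`, O'Brien 1990)] [cite: MadrasSlade1993, §7.1] -/
theorem count_le_count_succ_add_card_doublyTrapped_cutFree (d n : ℕ) :
    count d n ≤ count d (n + 1) + (doublyTrapped d n ∩ cutFree d n).card := by
  have h1 := count_add_sum_extCount_cutFree_le d n
  have h2 := card_cutFree_le d n
  omega

open Classical in
/-- **O'Brien's inequality at every length without cut-free doubly trapped walks**: if no doubly
trapped `n`-step walk on `ℤ^d` is cut-free, then `cₙ ≤ cₙ₊₁`. [cite: BDGS2012, §1.3 (`cₙ ≤ cₙ₊₁`, O'Brien 1990)] -/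
theorem count_le_count_succ_of_doublyTrapped_cutFree_eq_empty {n : ℕ}
    (h : doublyTrapped d n ∩ cutFree d n = ∅) : count d n ≤ count d (n + 1) := by
  have := count_le_count_succ_add_card_doublyTrapped_cutFree d n
  rw [h, Finset.card_empty, add_zero] at this
  exact this

open Classical in
/-- **Reduction of O'Brien's theorem to the cut-free walks (average form).** If at every length the
cut-free walks have on average at least one free extension
(`#cutFree d n ≤ Σ_{ψ cut-free} extCount ψ n`), then `cₙ ≤ cₙ₊₁`. [cite: BDGS2012, §1.3 (`cₙ ≤ cₙ₊₁`, O'Brien 1990)] -/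
theorem count_le_count_succ_of_card_cutFree_le_sum {n : ℕ}
    (h : (cutFree d n).card ≤ ∑ ψ ∈ cutFree d n, extCount ψ n) : count d n ≤ count d (n + 1) := by
  have := count_add_sum_extCount_cutFree_le d n
  omega

end Literature.Probability.RandomPlanarGeometry.SAW.Zd

end
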